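import Literature.NumberTheory.LFunctions.Zhang2022.SkeletonSetting
import HarnessLib

/-!
# Route `PrimeLevelFamEdge` — TYPED IDEA DELTAS, deck 28c (LANDING NOTE typer ls-idea-typ-1 gen 4: the seat's
# `HOME/ls-idea-lens-7/Sketch_Uquater_ExcSequence.lean` sha16 87501f7ed27be126 VERBATIM up to namespace
# `…BeyondDiagonalBeatsQuarter.OffDiag.LensSevenSketchUquater` → `…PrimeLevelFamEdgeIdeaDeltas.ExcZeroLedgerSequence`; landed as offered
# (lens-7 gen 28 ADDENDUM U⁗), companion of decks 28/28b; `ExcSequence A₀` is HYPOTHESIS-SHAPED by design (the seat's audit note).)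
#
# Sketch (cell ls-idea, seat lens-7 = I7-DEURING–HEILBRONN, gen 28) — crux idea
# `l7-exceptional-clause-two-term-ledger` on K_B `stmt-Parity-20343`, §U v2.0 piece **U-C**: typed → PROVED

OMEGA-BLUEPRINT node **L5′ `OffDiagTransition` ≡ U**, row (S) a8S-short, world (A).

Companion of `Sketch_Uter_SmallLOneWindowClean.lean` (U-B, U-D).  This file restates **U-C** (`ExcSequence`,
`FirstLemmaUC`) VERBATIM from `Sketch_U_ExcWorldLedger.lean` (sha16 7478f05b873579d8) and PROVES
`FirstLemmaUC A₀` for every `A₀`: the negation of the log-power lower bound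
`Literature.NumberTheory.LFunctions.Zhang2022.Skeleton.LOneLowerBound A₀` supplies real primitive characters of
ARBITRARILY LARGE modulus with `‖L(1,χ_D)‖ ≤ (log D)^{−A₀}` — pure logic plus two facts: `L(1,χ) ≠ 0` for
`χ ≠ χ₀` (Mathlib `DirichletCharacter.LFunction_ne_zero_of_one_le_re`) and the finiteness of the set of
characters to moduli `< D₀` (Mathlib `MulChar.finite`), which give a positive lower bound for `‖L(1,χ)‖` below
any fixed `D₀` (`exists_LOne_lower_below`, by induction on `D₀`).  The card (v2.0 §U) sized U-C «S: logic +
`L(1,χ) ≠ 0` + finiteness below `D₀`»; this is that proof.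

HONESTY.  No exceptional-zero theorem is proved by ideation: U-C is the by-contradiction entry into world (A)
(it produces small `L(1,χ)` only from the NEGATION of the target-shaped lower bound); nothing here bears on the
heart stub.
-/

noncomputable section

open Real

namespace Summit.Parity.GeneralizedHardyLittlewood.Theorems.PrimeLevelFamEdgeIdeaDeltas.ExcZeroLedgerSequence

open Literature.NumberTheory.LFunctions

/-- **(U-C) verbatim from §U v2.0** (`Sketch_U_ExcWorldLedger.lean` 7478f05b873579d8): the exceptional sequence —
arbitrarily large moduli with `‖L(1,χ_D)‖ ≤ (log D)^{−A₀}`. -/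
def ExcSequence (A₀ : ℕ) : Prop :=
  ∀ D₀ : ℕ, ∃ (D : ℕ) (_ : NeZero D) (χ : DirichletCharacter ℂ D),
    D₀ ≤ D ∧ χ.IsQuadratic ∧ χ.IsPrimitive ∧ ‖χ.LFunction 1‖ ≤ (Real.log D) ^ (-(A₀ : ℝ))

/-- **(U-C) verbatim from §U v2.0**: `¬ LOneLowerBound A₀ → ExcSequence A₀`. -/
def FirstLemmaUC (A₀ : ℕ) : Prop := ¬ Zhang2022.Skeleton.LOneLowerBound A₀ → ExcSequence A₀

/-- Finiteness below a fixed modulus: a positive lower bound for `‖L(1,χ)‖` over all non-trivial characters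
`χ` to moduli `D < D₀` (induction on `D₀`; at each modulus the finitely many characters have
`L(1,χ) ≠ 0`). [folklore; Mathlib `MulChar.finite`, `DirichletCharacter.LFunction_ne_zero_of_one_le_re`] -/
theorem exists_LOne_lower_below (D₀ : ℕ) :
    ∃ c : ℝ, 0 < c ∧ ∀ (D : ℕ) [NeZero D] (χ : DirichletCharacter ℂ D), D < D₀ → χ ≠ 1 →
      c ≤ ‖χ.LFunction 1‖ := by
  induction D₀ with
  | zero => exact ⟨1, one_pos, fun D _ χ hD _ => absurd hD (Nat.not_lt_zero _)⟩
  | succ D₀ ih =>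
    obtain ⟨c, hc, h⟩ := ih
    rcases Nat.eq_zero_or_pos D₀ with hz | hpos
    · refine ⟨c, hc, fun D _ χ hD _ => ?_⟩
      exfalso
      have := NeZero.ne D
      omega
    · haveI : NeZero D₀ := ⟨by omega⟩
      obtain ⟨χ₀, hχ₀⟩ := Finite.exists_min
        (fun χ : DirichletCharacter ℂ D₀ => if χ = 1 then (1 : ℝ) else ‖χ.LFunction 1‖)
      set m : ℝ := (if χ₀ = 1 then (1 : ℝ) else ‖χ₀.LFunction 1‖) with hm
      have hm0 : 0 < m := by
        rw [hm]
        split_ifs with h1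
        · exact one_pos
        · exact norm_pos_iff.mpr
            (DirichletCharacter.LFunction_ne_zero_of_one_le_re χ₀ (Or.inl h1) (by simp))
      refine ⟨min c m, lt_min hc hm0, fun D _ χ hD hχ => ?_⟩
      rcases Nat.lt_succ_iff_lt_or_eq.mp hD with hlt | heq
      · exact (min_le_left _ _).trans (h D χ hlt hχ)
      · subst heq
        have hle := hχ₀ χ
        simp only [if_neg hχ] at hle
        exact (min_le_right _ _).trans (hm ▸ hle)

/-- **U-C PROVED**: `¬ LOneLowerBound A₀ → ExcSequence A₀`, with the witness constant
`c₁ = min(c, 1)/2`, `c` the lower bound of `exists_LOne_lower_below D₀`. [folklore] -/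
theorem firstLemmaUC_holds (A₀ : ℕ) : FirstLemmaUC A₀ := by
  intro hnot D₀
  by_contra hno
  obtain ⟨c, hc, hlow⟩ := exists_LOne_lower_below D₀
  apply hnot
  set c₁ : ℝ := min c 1 / 2 with hc₁
  have hc₁0 : 0 < c₁ := by rw [hc₁]; positivity
  have hc₁c : c₁ < c := by
    rw [hc₁]
    have := min_le_left c 1
    have := lt_min hc one_pos
    linarith
  have hc₁1 : c₁ ≤ 1 := by
    rw [hc₁]
    have := min_le_right c 1
    have := lt_min hc one_pos
    linarith
  refine ⟨c₁, hc₁0, fun D _ χ hD hq hp => ?_⟩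
  have hDr : (3 : ℝ) ≤ D := by exact_mod_cast hD
  -- `log D ≥ 1` for `D ≥ 3 > e`
  have hlog1 : 1 ≤ Real.log D := by
    rw [Real.le_log_iff_exp_le (by linarith)]
    linarith [Real.exp_one_lt_d9]
  have hlog0 : 0 < Real.log D := by linarith
  have hpow1 : 1 ≤ Real.log D ^ A₀ := one_le_pow₀ hlog1
  have hpow0 : 0 < Real.log D ^ A₀ := by positivity
  have hχ : χ ≠ 1 := by
    rintro rfl
    rw [DirichletCharacter.isPrimitive_def, DirichletCharacter.conductor_one] at hp
    omega
  rcases lt_or_ge D D₀ with hlt | hge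
  · -- below `D₀`: the finite lower bound
    have h1 : c₁ / Real.log D ^ A₀ ≤ c₁ := div_le_self hc₁0.le hpow1
    have h2 := hlow D χ hlt hχ
    linarith
  · -- at or above `D₀`: otherwise `(D, χ)` is the missing witness of `ExcSequence`
    by_contra hle
    push Not at hle
    refine hno ⟨D, ‹NeZero D›, χ, hge, hq, hp, hle.trans ?_⟩
    rw [Real.rpow_neg hlog0.le, Real.rpow_natCast, div_eq_mul_inv]
    exact mul_le_of_le_one_left (inv_nonneg.mpr hpow0.le) hc₁1

/-- Ledger check: U-C holds for every exponent, in particular the card's `A₀ = 2022` (Zhang's shape) and any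
`A₀ > 1 + deg Λ_U`. -/
example : ∀ A₀ : ℕ, FirstLemmaUC A₀ := firstLemmaUC_holds

end Summit.Parity.GeneralizedHardyLittlewood.Theorems.PrimeLevelFamEdgeIdeaDeltas.ExcZeroLedgerSequence

end
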